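import Summits.ValiantsHypothesis.ValiantsHypothesis.Theorems.GrenetZeonDualUnipotentThreeHalvesHeavyTopTowerDefs

/-!
# `GrenetZeon.DualUnipotentThreeHalves` (stmt-ValiantsHypothesis-24318), R2 heavy-top instrument — the TOWER HULL `T(p, I, q)`:
# the SANITY CASE `p = q = 0` (`T(0, I, 0) = I`; director R504-htc (2)(b), lead (γ), critic (δ))

With no outer blocks the tower hull is the middle block itself: `B ∈ towerHull 0 0 I ↔ midBlock 0 0 B ∈ I`, and along the canonical
re-indexing `Fin 3 ≃ Fin (0 + 3 + 0)` every `I ≤ M₃(ℂ)` satisfies the second disjunct of COROLLARY II with `p = q = 0`, `P = 1`: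
`A ∈ I ↔ reindex e e (1 * A * 1⁻¹) ∈ towerHull 0 0 I`.  This is the `m = 3`, irreducible base case of the classification (an irreducible
nilpotent plane of `M₃(ℂ)` is its own tower) and the reading of the junk-free small cases asked for by the critic.

* `blk_zero_eq_one` — every index of `Fin (0 + 3 + 0)` is in the middle block;
* `mem_towerHull_zero_zero` — `B ∈ T(0, I, 0) ↔ midBlock 0 0 B ∈ I`;
* `midBlock_zero_zero_reindex` — the middle block of the re-indexed `A : M₃(ℂ)` is `A`;
* ★ `exists_tower_zero_zero_self` — the COROLLARY II disjunct-2 data `(e, P) = (finCongr, 1)` for `V = I ≤ M₃(ℂ)`, `p = q = 0`.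

Honest framing: bookkeeping; nothing here proves or refutes `HeavyTopLaw`, 24318, S3b or 8062; `VP ≠ VNP` is NOT proved.  No definitions.
[val-idea-30 MEMO codim-one §4 (ii); cell val-heavytop-census, eng-1 g5]
-/

noncomputable section

-- single-conjunct layout: Sub = Summit, duplicated namespace component intended
set_option linter.dupNamespace false

namespace Summit.ValiantsHypothesis.ValiantsHypothesis.Theorems.GrenetZeon.HeavyTopTowerBase

open Matrix
open Summit.ValiantsHypothesis.ValiantsHypothesis.Theorems.GrenetZeon.HeavyTopTowerDefs

/-- With `p = q = 0` every index lies in the middle block. -/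
theorem blk_zero_eq_one (i : Fin (0 + 3 + 0)) : blk 0 i = 1 := by
  have hi := i.isLt
  simp only [blk]
  rw [if_neg (by omega), if_pos (by omega)]

/-- `B ∈ T(0, I, 0) ↔ midBlock 0 0 B ∈ I`: the shape conditions are vacuous. -/
theorem mem_towerHull_zero_zero {I : Submodule ℂ (Matrix (Fin 3) (Fin 3) ℂ)} {B : Matrix (Fin (0 + 3 + 0)) (Fin (0 + 3 + 0)) ℂ} :
    B ∈ towerHull 0 0 I ↔ midBlock 0 0 B ∈ I := by
  rw [mem_towerHull]
  refine ⟨fun h => h.2, fun h => ⟨⟨fun i j hij => ?_, fun i j _ h1 _ => absurd (blk_zero_eq_one i) h1⟩, h⟩⟩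
  rw [blk_zero_eq_one, blk_zero_eq_one] at hij
  exact absurd hij (lt_irrefl _)

/-- The middle block of the re-indexed `A : M₃(ℂ)` is `A`. -/
theorem midBlock_zero_zero_reindex (h : 3 = 0 + 3 + 0) (A : Matrix (Fin 3) (Fin 3) ℂ) :
    midBlock 0 0 (Matrix.reindex (finCongr h) (finCongr h) A) = A := by
  ext a b
  rw [midBlock_apply, Matrix.reindex_apply, Matrix.submatrix_apply]
  congr 1 <;> apply Fin.ext <;> simp

/-- ★ **Sanity case `p = q = 0`: every `I ≤ M₃(ℂ)` is its own tower `T(0, I, 0)`** — the data `(e, P) = (finCongr _, 1)` of the second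
disjunct of COROLLARY II for `V = I`. [val-idea-30 MEMO codim-one §4 (ii), base case] -/
theorem exists_tower_zero_zero_self (I : Submodule ℂ (Matrix (Fin 3) (Fin 3) ℂ)) :
    ∃ (e : Fin 3 ≃ Fin (0 + 3 + 0)) (P : Matrix (Fin 3) (Fin 3) ℂ), IsUnit P ∧
      ∀ A, A ∈ I ↔ Matrix.reindex e e (P * A * P⁻¹) ∈ towerHull 0 0 I := by
  refine ⟨finCongr (by norm_num), 1, isUnit_one, fun A => ?_⟩
  rw [one_mul, inv_one, mul_one, mem_towerHull_zero_zero, midBlock_zero_zero_reindex]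

end Summit.ValiantsHypothesis.ValiantsHypothesis.Theorems.GrenetZeon.HeavyTopTowerBase

end
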